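import Literature.AlgebraicGeometry.Resolution.StrictTransformClosedSetPieces
import Literature.AlgebraicGeometry.Resolution.BlowupOffCentre
import Literature.AlgebraicGeometry.Resolution.MaximalPoints
import Literature.AlgebraicGeometry.Resolution.StalkIdealLemmas
import HarnessLib

/-!
# Strict transforms of curves off the centre of a blowing up: generic points, maximal points of the order locus,
# and persistence of transversality (CoP1, Prop. 4.4, steps 1–3)

Topic: `Literature/AlgebraicGeometry/Resolution`. [CoP1] = Cossart–Piltant, J. Algebra 320 (2008) 1051–1082, proof of Prop. 4.4, p. 10:
the algorithm follows the one-dimensional irreducible components of `Σ(i) = {ord = μ}` through blowing ups of points and curves — «the strict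
transform of `Σ` in `X′`», «`n(i+1) ≤ n(i)`», «each exceptional curve … is transverse to the strict transforms of each one dimensional
irreducible component». The common bookkeeping for a blowing up `π : X′ → X` along `J` (Görtz–Wedhorn I, Prop. 13.91 (3): an isomorphism
over `X ∖ V(J)`), all PROVED, def-free, fact-free (glue (g1′) and the «strict transform» halves of the census rows ρ1/ρ2 of the F-71 REACH
decomposition, `plan/inputs/candidates/F71_REACH_DECOMPOSITION_SIGNATURE_p5a.lean`, cell res-hironaka):

* `IsBlowup.existsUnique_preimage_of_not_mem_support`, `IsBlowup.specializes_of_apply_specializes` — off the centre, points have unique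
  preimages and specialisations lift;
* `IsBlowup.closure_preimage_diff_support_eq_closure_singleton` — **the strict transform `cl(π⁻¹(cl{η} ∖ V(J)))` of the closure of a
  point `η ∉ V(J)` is the closure of the point `η̃` over `η`**;
* `IsBlowup.mem_maxPoints_setOf_le_idealOrder_iff` — **for the weak transform `J′ = πᶜ(I, b)` and `x′` off the exceptional divisor,
  `x′` is a maximal point of `{b ≤ ord J′}` iff `π x′` is a maximal point of `{b ≤ ord I}`** (orders do not change off the centre,
  `IsBlowup.idealOrder_controlledTransform_of_not_mem`);
* `sup_eq_maximalIdeal_of_forall_exists_sub_mem` (local rings), `sup_stalkIdeal_vanishingIdeal_eq_maximalIdeal_of_surjective` —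
  **transversality persists: if `𝒪_{X,x} → 𝒪_{X′,c′}/𝓘_{D̃₁,c′}` is onto (e.g. `D̃₁ ≅ D₁`, the strict transform of a curve transverse to the
  centre) and `𝓘_{D₁,x} + 𝓘_{D₂,x} = 𝔪_x`, then `𝓘_{D̃₁,c′} + 𝓘_{D̃₂,c′} = 𝔪_{c′}`** for any closed `D̃ᵢ ⊆ π⁻¹ Dᵢ` through `c′`
  (the proof of [CoP1]'s «hence to `Γ′` if all components of `Γ` meet transversally»).

## Sources

* V. Cossart, O. Piltant, J. Algebra 320 (2008) 1051–1082, proof of Prop. 4.4, p. 10. [CossartPiltant2008]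
* U. Görtz, T. Wedhorn, *Algebraic Geometry I*, 2nd ed. (2020), Prop. 13.91 (3), (13.19) p. 414. [GortzWedhorn2020]
-/

noncomputable section

open CategoryTheory AlgebraicGeometry TopologicalSpace IsLocalRing

namespace Literature.AlgebraicGeometry.Resolution

universe u

open Scheme.IdealSheafData

/-! ## § 1 Points off the centre -/

section OffCentre

variable {X X' : Scheme.{u}} {π : X' ⟶ X} {J : X.IdealSheafData}

/-- **Off the centre a blowing up is bijective on points**: every `z ∉ V(J)` has exactly one preimage (the blowing up restricts to an
isomorphism over `X ∖ V(J)`). [cite: GortzWedhorn2020, Prop. 13.91 (3)] -/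
theorem IsBlowup.existsUnique_preimage_of_not_mem_support (hπ : IsBlowup π J) {z : X}
    (hz : z ∉ (J.support : Set X)) : ∃! z' : X', π z' = z := by
  set W : X.Opens := ⟨(J.support : Set X)ᶜ, J.support.isClosed.isOpen_compl⟩ with hW
  haveI : IsIso (π ∣_ W) := hπ.isIso_compl
  have hbij := ConcreteCategory.bijective_of_isIso ((π ∣_ W).base)
  obtain ⟨w, hw⟩ := hbij.2 ⟨z, hz⟩
  refine ⟨w.1, by simpa [morphismRestrict_base_coe] using congrArg Subtype.val hw, fun z' hz' => ?_⟩
  have hz'W : z' ∈ π ⁻¹ᵁ W := by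
    change π z' ∈ (J.support : Set X)ᶜ
    rw [hz']
    exact hz
  have h : (π ∣_ W) ⟨z', hz'W⟩ = (π ∣_ W) w := by
    rw [hw]
    exact Subtype.ext (by rw [morphismRestrict_base_coe]; exact hz')
  exact congrArg Subtype.val (hbij.1 h)

/-- **Specialisations lift off the centre**: if `π η′ ⤳ π z′` with `π η′, π z′ ∉ V(J)` then `η′ ⤳ z′` (over `X ∖ V(J)` the blowing up
is an open immersion). [cite: GortzWedhorn2020, Prop. 13.91 (3)] -/
theorem IsBlowup.specializes_of_apply_specializes (hπ : IsBlowup π J) {η' z' : X'}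
    (hη : π η' ∉ (J.support : Set X)) (hz : π z' ∉ (J.support : Set X)) (h : π η' ⤳ π z') : η' ⤳ z' := by
  let V : X'.Opens := π ⁻¹ᵁ centreCompl J
  let F : (V : Scheme.{u}) ⟶ X := V.ι ≫ π
  haveI : IsOpenImmersion F := hπ.isOpenImmersion_preimage_compl_ι
  have hη'V : η' ∈ V := hη
  have hz'V : z' ∈ V := hz
  have e1 : F ⟨η', hη'V⟩ = π η' := by
    change π (V.ι ⟨η', hη'V⟩) = π η'
    rw [Scheme.Opens.ι_apply]
  have e2 : F ⟨z', hz'V⟩ = π z' := by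
    change π (V.ι ⟨z', hz'V⟩) = π z'
    rw [Scheme.Opens.ι_apply]
  have h1 : F ⟨η', hη'V⟩ ⤳ F ⟨z', hz'V⟩ := by rw [e1, e2]; exact h
  have h2 : (⟨η', hη'V⟩ : V) ⤳ ⟨z', hz'V⟩ := F.isOpenEmbedding.isInducing.specializes_iff.mp h1
  have h3 := h2.map V.ι.continuous
  rwa [Scheme.Opens.ι_apply, Scheme.Opens.ι_apply] at h3

/-- **The strict transform of the closure of a point off the centre is the closure of its preimage**: for `η ∉ V(J)` and the point
`η̃` over it, `cl(π⁻¹(cl{η} ∖ V(J))) = cl{η̃}` (Görtz–Wedhorn (13.19): the strict transform is the closure of `π⁻¹(Z ∖ V(J))`).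
[cite: GortzWedhorn2020, (13.19) p. 414] -/
theorem IsBlowup.closure_preimage_diff_support_eq_closure_singleton (hπ : IsBlowup π J) {η : X} {η' : X'}
    (hη' : π η' = η) (hη : η ∉ (J.support : Set X)) :
    closure (π ⁻¹' (closure {η} \ (J.support : Set X))) = closure {η'} := by
  apply le_antisymm
  · refine closure_minimal ?_ isClosed_closure
    rintro z' ⟨hz'cl, hz'J⟩
    have hsp : η ⤳ π z' := specializes_iff_mem_closure.mpr hz'cl
    rw [← hη'] at hsp
    exact specializes_iff_mem_closure.mp
      (hπ.specializes_of_apply_specializes (by rw [hη']; exact hη) hz'J hsp)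
  · refine closure_minimal (Set.singleton_subset_iff.mpr (subset_closure ?_)) isClosed_closure
    refine ⟨?_, ?_⟩
    · show π η' ∈ closure {η}
      rw [hη']
      exact subset_closure rfl
    · show π η' ∉ (J.support : Set X)
      rw [hη']
      exact hη

/-- **Maximal points of the order locus off the exceptional divisor**: for the weak transform `J′ = πᶜ(I, b)` and `x′` with
`π x′ ∉ V(J)`, `x′` is a maximal point of `{b ≤ ord J′}` iff `π x′` is a maximal point of `{b ≤ ord I}` (orders agree off the centre,
specialisations lift, preimages are unique). [cite: CossartPiltant2008, Prop. 4.4 (proof, p. 10)] -/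
theorem IsBlowup.mem_maxPoints_setOf_le_idealOrder_iff (hπ : IsBlowup π J) (I : X.IdealSheafData) (b : ℕ) (m : ℕ∞)
    {x' : X'} (hx : π x' ∉ (J.support : Set X)) :
    x' ∈ maxPoints {z : X' | m ≤ idealOrder (controlledTransform π J I b) z} ↔
      π x' ∈ maxPoints {z : X | m ≤ idealOrder I z} := by
  -- a generisation of a point off the (closed) centre is off the centre
  have hgen : ∀ {ζ z : X}, ζ ⤳ z → z ∉ (J.support : Set X) → ζ ∉ (J.support : Set X) := fun hsp hz hζ =>
    hz (hsp.mem_closed J.support.isClosed hζ)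
  have hord : ∀ {z' : X'}, π z' ∉ (J.support : Set X) →
      idealOrder (controlledTransform π J I b) z' = idealOrder I (π z') := fun hz =>
    hπ.idealOrder_controlledTransform_of_not_mem I b hz
  constructor
  · rintro ⟨hxS, hmax⟩
    refine ⟨by simpa only [Set.mem_setOf_eq, ← hord hx] using hxS, fun ζ hζS hζ => ?_⟩
    have hζJ : ζ ∉ (J.support : Set X) := hgen hζ hx
    obtain ⟨ζ', hζ', -⟩ := hπ.existsUnique_preimage_of_not_mem_support hζJ
    have hsp : ζ' ⤳ x' := hπ.specializes_of_apply_specializes (by rw [hζ']; exact hζJ) hx (by rw [hζ']; exact hζ)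
    have hζ'S : ζ' ∈ {z : X' | m ≤ idealOrder (controlledTransform π J I b) z} := by
      simp only [Set.mem_setOf_eq]
      rw [hord (by rw [hζ']; exact hζJ), hζ']
      exact hζS
    rw [← hζ', hmax ζ' hζ'S hsp]
  · rintro ⟨hxS, hmax⟩
    refine ⟨by simpa only [Set.mem_setOf_eq, hord hx] using hxS, fun ζ' hζ'S hζ' => ?_⟩
    have hsp : π ζ' ⤳ π x' := hζ'.map π.continuous
    have hζJ : π ζ' ∉ (J.support : Set X) := hgen hsp hx
    have hζS : π ζ' ∈ {z : X | m ≤ idealOrder I z} := by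
      simp only [Set.mem_setOf_eq]
      rw [← hord hζJ]
      exact hζ'S
    have heq : π ζ' = π x' := hmax _ hζS hsp
    obtain ⟨w, -, huniq⟩ := hπ.existsUnique_preimage_of_not_mem_support hx
    exact (huniq ζ' heq).trans (huniq x' rfl).symm

end OffCentre

/-! ## § 2 Persistence of transversality -/

section Transversal

/-- **Transversality persists along a surjection** (ring level). Let `φ : R → R′` be a local homomorphism of local rings, `I₁ + I₂ = 𝔪_R`,
`I₁′, I₂′ ⊆ 𝔪_{R′}` ideals containing `φ(I₁)`, `φ(I₂)` respectively, and suppose `R → R′/I₁′` is onto (every `z` is `φ(r)` modulo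
`I₁′`). Then `I₁′ + I₂′ = 𝔪_{R′}`. [cite: CossartPiltant2008, Prop. 4.4 (proof, p. 10)] -/
theorem sup_eq_maximalIdeal_of_forall_exists_sub_mem {R R' : Type*} [CommRing R] [CommRing R'] [IsLocalRing R]
    [IsLocalRing R'] (φ : R →+* R') [IsLocalHom φ] {I₁ I₂ : Ideal R} {I₁' I₂' : Ideal R'}
    (h₁ : I₁.map φ ≤ I₁') (h₂ : I₂.map φ ≤ I₂') (hI₁' : I₁' ≤ maximalIdeal R') (hI₂' : I₂' ≤ maximalIdeal R')
    (hsurj : ∀ z : R', ∃ r : R, z - φ r ∈ I₁') (htr : I₁ ⊔ I₂ = maximalIdeal R) :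
    I₁' ⊔ I₂' = maximalIdeal R' := by
  refine le_antisymm (sup_le hI₁' hI₂') fun z hz => ?_
  obtain ⟨r, hr⟩ := hsurj z
  have hφr : φ r ∈ maximalIdeal R' := by
    have : φ r = z - (z - φ r) := by ring
    rw [this]
    exact sub_mem hz (hI₁' hr)
  have hrm : r ∈ maximalIdeal R := by
    rw [IsLocalRing.mem_maximalIdeal, mem_nonunits_iff] at hφr ⊢
    exact fun h => hφr (h.map φ)
  rw [← htr] at hrm
  obtain ⟨a, ha, c, hc, rfl⟩ := Submodule.mem_sup.mp hrm
  have : z = (z - φ (a + c)) + (φ a + φ c) := by rw [map_add]; ring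
  rw [this]
  exact add_mem (Ideal.mem_sup_left hr)
    (add_mem (Ideal.mem_sup_left (h₁ (Ideal.mem_map_of_mem φ ha))) (Ideal.mem_sup_right (h₂ (Ideal.mem_map_of_mem φ hc))))

variable {X X' : Scheme.{u}}

/-- The ideal of a closed set pulls back into the ideal of any closed subset of its preimage: for `f : X′ → X`, `D ⊆ X` and `D′ ⊆ f⁻¹ D`
closed, `𝓘_{D,f c′} · 𝒪_{X′,c′} ⊆ 𝓘_{D′,c′}`. [folklore] -/
private theorem map_stalkIdeal_vanishingIdeal_le_of_subset_preimage (f : X' ⟶ X) {D : Closeds X} {D' : Closeds X'}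
    (h : (D' : Set X') ⊆ f ⁻¹' (D : Set X)) (c' : X') :
    (stalkIdeal (vanishingIdeal D) (f c')).map (f.stalkMap c').hom ≤ stalkIdeal (vanishingIdeal D') c' := by
  rw [← stalkIdeal_comap_eq_map_stalkMap]
  refine stalkIdeal_mono ?_ c'
  calc (vanishingIdeal D).comap f
      ≤ ((vanishingIdeal D).comap f).radical := Scheme.IdealSheafData.le_radical _
    _ = vanishingIdeal (D.preimage f.continuous) := (vanishingIdeal_preimage f D).symm
    _ ≤ vanishingIdeal D' := vanishingIdeal_antimono h

/-- **Transversality persists for strict transforms** ([CoP1] p. 10: the strict transform of a curve transverse to the centre is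
transverse «hence to `Γ′` if all components of `Γ` meet transversally»). Let `f : X′ → X`, `D₁, D₂ ⊆ X` closed with
`𝓘_{D₁,x} + 𝓘_{D₂,x} = 𝔪_x` at `x = f c′`, and `D₁′ ⊆ f⁻¹D₁`, `D₂′ ⊆ f⁻¹D₂` closed through `c′` such that
`𝒪_{X,x} → 𝒪_{X′,c′}/𝓘_{D₁′,c′}` is onto (for the strict transform of a regular curve transverse to a regular centre this is the content of
`D̃₁ ≅ D₁`). Then `𝓘_{D₁′,c′} + 𝓘_{D₂′,c′} = 𝔪_{c′}`. [cite: CossartPiltant2008, Prop. 4.4 (proof, p. 10)] -/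
theorem sup_stalkIdeal_vanishingIdeal_eq_maximalIdeal_of_surjective (f : X' ⟶ X) {D₁ D₂ : Closeds X}
    {D₁' D₂' : Closeds X'} (h₁ : (D₁' : Set X') ⊆ f ⁻¹' (D₁ : Set X)) (h₂ : (D₂' : Set X') ⊆ f ⁻¹' (D₂ : Set X))
    {c' : X'} (hc₁ : c' ∈ D₁') (hc₂ : c' ∈ D₂')
    (hsurj : ∀ z : X'.presheaf.stalk c', ∃ r : X.presheaf.stalk (f c'),
      z - (f.stalkMap c').hom r ∈ stalkIdeal (vanishingIdeal D₁') c')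
    (htr : stalkIdeal (vanishingIdeal D₁) (f c') ⊔ stalkIdeal (vanishingIdeal D₂) (f c') = maximalIdeal _) :
    stalkIdeal (vanishingIdeal D₁') c' ⊔ stalkIdeal (vanishingIdeal D₂') c' = maximalIdeal _ := by
  have hle : ∀ {D' : Closeds X'}, c' ∈ D' → stalkIdeal (vanishingIdeal D') c' ≤ maximalIdeal _ := fun hc =>
    (mem_support_iff_stalkIdeal_le _ _).mp (by rw [← SetLike.mem_coe, coe_support_vanishingIdeal]; exact hc)
  exact sup_eq_maximalIdeal_of_forall_exists_sub_mem (f.stalkMap c').hom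
    (map_stalkIdeal_vanishingIdeal_le_of_subset_preimage f h₁ c')
    (map_stalkIdeal_vanishingIdeal_le_of_subset_preimage f h₂ c') (hle hc₁) (hle hc₂) hsurj htr

end Transversal

end Literature.AlgebraicGeometry.Resolution

end
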